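import Summits.NavierStokesRegularity.NavierStokesRegularity.Theses.PumpContinuation
import Summits.NavierStokesRegularity.NavierStokesRegularity.Theorems.PerpetualPumpEulerTypeIGlue
import Literature.Barriers.NavierStokesRegularity.AveragedTypeIBlowup

/-!
# Route PumpContinuation · crux `EulerProximatePump` (stmt-NavierStokesRegularity-18302) · line `SketchIdeator2`
# Stub `stub_classicalTypeIToMild`: classical ⇒ Tao-mild at the Euler end

A maximal smooth solution `(u, p)` of Navier–Stokes with viscosity `ν > 0` and zero force on `[0,T)`
(`IsMaximalSmoothSolution ν 0 u p T`), Leray–Hopf from its rapidly decaying datum and blowing up at most at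
the Type-I rate, yields a Schwartz divergence-free datum, a time `S = νT > 0` and an `H¹⁰_df`-mild solution
of Tao's unit-viscosity Euler-form equation `∂ₜU = ΔU + B(U,U)` on `[0,S)` with the `L^∞` rate
`‖U s‖_∞ ≤ M/√(S-s)` and NO mild extension past `S`. This is the Euler-datum half of the proved crux
`PerpetualPump.EulerTypeIGlue` (stmt-1838, `perpetualPump_eulerTypeIGlue_proof`) read forwards: the seven
landed stubs of that line (`stub_memH10`, `stub_continuity`, `stub_identityTests`, `stub_cubic`,
`stub_testToH10`, `stub_normalise`, `stub_backEnd`) are re-assembled against maximality instead of the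
Thesis — a mild extension would, by the back end (Robinson–Rodrigo–Sadowski Thm. 8.17), continue `u`
classically past `T`.

## References

* T. Tao, J. Amer. Math. Soc. 29 (2016), arXiv:1402.0290v3, §1.1 (1.3)–(1.5), (1.15). [Tao2016AveragedNS]
* J. C. Robinson, J. L. Rodrigo, W. Sadowski, *The three-dimensional Navier–Stokes equations* (2016),
  Thm. 8.17. [RobinsonRodrigoSadowski2016]
-/

noncomputable section

open MeasureTheory Set Filter Topology
open scoped ENNReal NNReal SchwartzMap ContDiff

-- the nested summit namespace `…NavierStokesRegularity.NavierStokesRegularity…` is the tree's layout (D-0017)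
set_option linter.dupNamespace false

namespace Summit.NavierStokesRegularity.NavierStokesRegularity.Theorems

open Literature.Analysis.FluidPDE Literature.Analysis.FluidPDE.Tao2016
open Literature.Analysis.FunctionSpaces.EuclideanSpace (complexify complexify_apply norm_complexify)

namespace PumpContinuationEulerProximatePump

/-- **Stub `stub_classicalTypeIToMild` (bookkeeping, classical ⇒ Tao-mild at the Euler end).** A maximal smooth
solution of Navier–Stokes (viscosity `ν > 0`, zero force) on `[0,T)` which is Leray–Hopf from its rapidly decaying
datum and blows up at most at the Type-I rate yields — after the time rescaling `ν ↦ 1` and complexification — a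
Schwartz divergence-free datum `u₀`, a time `S > 0` and an `H¹⁰_df`-mild solution of `∂ₜu = Δu + B(u,u)` (Tao (1.5))
on `[0,S)` with `‖U t‖_∞ ≤ M/√(S-t)` and NO mild extension past `S` (a mild extension would bound `u` in `L^∞` up
to `T` and continue it classically, against maximality). [cite: Tao2016AveragedNS, §1.1 (1.3)-(1.5), (1.15)] -/
theorem stub_classicalTypeIToMild :
    ∀ ν : ℝ, 0 < ν → ∀ T : ℝ, 0 < T →
      ∀ (u : ℝ → EuclideanSpace ℝ (Fin 3) → EuclideanSpace ℝ (Fin 3))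
        (p : ℝ → EuclideanSpace ℝ (Fin 3) → ℝ),
      IsMaximalSmoothSolution ν 0 u p T → IsLerayHopfOn T ν 0 (u 0) u →
      HasRapidSpatialDecay (u 0) → IsTypeIBlowup u T →
      ∃ M : ℝ, ∃ u₀ : SchwartzMap (EuclideanSpace ℝ (Fin 3)) (EuclideanSpace ℝ (Fin 3)),
        VectorCalculus.IsDivFree ⇑u₀ ∧ ∃ S : ℝ, 0 < S ∧ ∃ U : ℝ → L2C,
          IsMildSolutionFor eulerForm (schwartzL2 u₀) (Ico 0 S) U ∧
          (∀ t ∈ Ico 0 S, eLpNorm (U t) ⊤ volume ≤ ENNReal.ofReal (M / Real.sqrt (S - t))) ∧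
          ¬ ∃ S' : ℝ, S < S' ∧ ∃ v : ℝ → L2C,
              IsMildSolutionFor eulerForm (schwartzL2 u₀) (Ico 0 S') v ∧ ∀ t ∈ Ico 0 S, v t = U t := by
  intro ν hν T hT u p hmax hLH hdec hTI
  have hcl : IsClassicalNSSolutionOn (Ico 0 T) ν 0 u p := hmax.1
  -- (0) slab bounds and the Type-I rate on all of `[0,T)`
  have hslab := exists_forall_norm_le_of_tao2011 tao2011_hasBoundedSobolevNormsOn_holds hν hcl hLH hdec
  obtain ⟨C, hC⟩ := hTI.exists_sqrt_mul_norm_le (PerpetualPumpEulerTypeIGlue.forall_lt_exists_bound hT hslab)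
  -- (1) the Tao-side curve `U t = [(u t)^ℂ]`
  have h2 : ∀ t ∈ Ico 0 T, MemLp (complexify ∘ u t) 2
      (volume : Measure (EuclideanSpace ℝ (Fin 3))) := fun t ht =>
    PerpetualPumpEulerTypeIGlue.memLp_complexify_of_memLp (hLH.memLp t ⟨ht.1, ht.2.le⟩)
  classical
  set U : ℝ → L2C := fun t => if ht : t ∈ Ico 0 T then (h2 t ht).toLp _ else 0 with hUdef
  have hU_eq : ∀ t (ht : t ∈ Ico 0 T), U t = (h2 t ht).toLp _ := fun t ht => by
    simp only [hUdef, dif_pos ht]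
  have hU : ∀ t ∈ Ico 0 T, ((U t : L2C) : EuclideanSpace ℝ (Fin 3) → EuclideanSpace ℂ (Fin 3))
      =ᵐ[volume] complexify ∘ u t := fun t ht => by
    rw [hU_eq t ht]
    exact (h2 t ht).coeFn_toLp
  have h0T : (0 : ℝ) ∈ Ico 0 T := ⟨le_rfl, hT⟩
  -- (2) regularity of the curve and Tao's identity at viscosity `ν`
  have hH : ∀ t ∈ Ico 0 T, MemH10df (U t) :=
    PerpetualPumpEulerTypeIGlue.stub_memH10 hν hcl hLH hdec U hU
  have hc : ContinuousInH10On (Ico 0 T) U :=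
    PerpetualPumpEulerTypeIGlue.stub_continuity hν hT hcl hLH hdec U hU
  have hid := PerpetualPumpEulerTypeIGlue.stub_testToH10 U hH hc
    (PerpetualPumpEulerTypeIGlue.stub_identityTests hν hT hcl hLH hdec U hU hH
      (fun hf h2 hH hdf hψ hψ1 hψ' hψ2 =>
        PerpetualPumpEulerTypeIGlue.stub_cubic hf h2 hH hdf hψ hψ1 hψ' hψ2))
  -- (3) the datum as a Schwartz map
  obtain ⟨u₀, hu₀⟩ := PerpetualPumpEulerTypeIGlue.exists_schwartzMap_coe_eq
    (hcl.contDiff_velocity h0T) hdec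
  have hU0 : U 0 = schwartzL2 u₀ := by
    rw [hU_eq 0 h0T]
    exact MemLp.toLp_congr _ _ (Eventually.of_forall fun x => by rw [hu₀])
  -- (4) the Type-I rate in `L^∞` form
  have hrate : ∃ M : ℝ, ∀ t ∈ Ico 0 T,
      eLpNorm (U t) ⊤ volume ≤ ENNReal.ofReal (M / Real.sqrt (T - t)) := by
    refine ⟨C, fun t ht => ?_⟩
    have hpos : 0 < Real.sqrt (T - t) := Real.sqrt_pos.2 (sub_pos.2 ht.2)
    rw [eLpNorm_congr_ae (hU t ht), eLpNorm_exponent_top]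
    refine eLpNormEssSup_le_of_ae_bound (Eventually.of_forall fun x => ?_)
    rw [Function.comp_apply, norm_complexify, le_div_iff₀ hpos, mul_comm]
    exact hC t ht x
  -- (5) normalise the viscosity: `W s = ν⁻¹ • U (s/ν)` on `[0, νT)`
  obtain ⟨hW, M, hM⟩ := PerpetualPumpEulerTypeIGlue.stub_normalise hν u₀ U hU0 hH hc hid hrate
  have hdiv₀ : VectorCalculus.IsDivFree ⇑((ν⁻¹ : ℝ) • u₀) := by
    have h1 : ContDiff ℝ 1 (u 0) := (hcl.contDiff_velocity h0T).of_le (mod_cast le_top)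
    have h := PerpetualPumpEulerTypeIGlue.isDivFree_const_smul h1 (hcl.divFree 0 h0T) ν⁻¹
    rwa [← hu₀] at h
  have hW' : IsMildSolutionFor eulerForm (schwartzL2 ((ν⁻¹ : ℝ) • u₀)) (Ico 0 (ν * T))
      (fun s => ((ν⁻¹ : ℝ) : ℂ) • U (s / ν)) := by
    have h : IsMildSolutionFor AveragingDatum.euler.form (schwartzL2 ((ν⁻¹ : ℝ) • u₀))
        (Ico 0 (ν * T)) (fun s => ((ν⁻¹ : ℝ) : ℂ) • U (s / ν)) := hW
    rwa [Literature.Barriers.NavierStokesRegularity.AveragedTypeI.euler_form_eq] at h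
  refine ⟨M, (ν⁻¹ : ℝ) • u₀, hdiv₀, ν * T, mul_pos hν hT, fun s => ((ν⁻¹ : ℝ) : ℂ) • U (s / ν),
    hW', hM, ?_⟩
  -- (6) no mild extension: an extension past `νT` would continue `u` classically past `T`
  rintro ⟨T', hT', v, hv, hvW⟩
  refine hmax.2 (PerpetualPumpEulerTypeIGlue.stub_backEnd (a := ν⁻¹) (b := ν) hν hT (inv_pos.2 hν) hν
    hT' hcl hLH hdec v hv.1 hv.2.1 ?_)
  intro t ht
  have hνt : ν * t ∈ Ico 0 (ν * T) := ⟨mul_nonneg hν.le ht.1, mul_lt_mul_of_pos_left ht.2 hν⟩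
  rw [hvW (ν * t) hνt]
  dsimp only
  rw [mul_div_cancel_left₀ t hν.ne']
  filter_upwards [Lp.coeFn_smul (((ν⁻¹ : ℝ) : ℂ)) (U t), hU t ht] with x hx hx'
  rw [hx, Pi.smul_apply, hx', Function.comp_apply]

end PumpContinuationEulerProximatePump

end Summit.NavierStokesRegularity.NavierStokesRegularity.Theorems

end
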